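import Summits.QuantumFields.YangMills.Theorems.CurvatureSandwichBound.Negative.Inhabitants

/-!
# `CurvatureSandwichBound` (Σ) — negative-side support IV: the constant field meets EVERY model-blind clause of the
hypotheses (OS package E0–E4 incl. E0', translations, hypercubic invariance, continuum gap, eight frames, planar
cone, soft kernel)

Support file for crux `stmt-QuantumFields-18372` (refuter, cdisprove), extracted from the work file
`Cruxes/CurvatureSandwichBound/Disproof.lean`.  Tree objects only; nothing is posited.  With support file V
(`TiedConstField.lean`: a `β ≡ 0` scheme TIES the constant field, so `W1` holds) the constant field `φ ≡ κ` becomes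
the first certified NON-VACUUM inhabitant of the common hypothesis set of Σ, B, B′ (and of `W₁` for T, K, D): its
field vectors `Ψ_F = κⁿ (∫F) Ω` are non-zero.

* `isNormalized_constField`, `isHermitian_constField`, `hasLinearGrowth_constField` (E0' with `s = 5`, `β = 1`:
  `|∫ F| ≤ (32 J)ⁿ |F|_{5n}`, `J = ∫_{ℝ⁴}(1+|y|)^{-5} dy`, and `cⁿ ≤ e^c n!`), `isSymmetric_constField`,
  `hasClusterProperty_constField`, `osPackage_constField`;
* `translations_constField`, `hypercubic_constField`, `hasMassGap_constField` (every `Δ`, constant `0`);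
* `eightFrameRP_constField` (landed `constField_pullback_isReflectionPositive`), `planarCone_constField`
  (`Φ ≡ κ^{n+m} conj(∫F) ∫G`, Cauchy–Schwarz an equality), `softKernel_constField` (`K ≡ κ²`, `η = 1`).
-/

noncomputable section

namespace Summit.QuantumFields.YangMills.Theorems.CurvatureSandwichBound.Negative

open scoped BigOperators SchwartzMap ComplexConjugate InnerProductSpace ENNReal
open MeasureTheory Filter Topology Complex
open Literature.MathematicalPhysics.QuantumLattice Literature.MathematicalPhysics.AQFT
  Literature.MathematicalPhysics.QuantumFieldTheory
open Summit.QuantumFields.YangMills.Theorems.NPointIsotropy.Negative (E4)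
open Summit.QuantumFields.YangMills.Theorems.CurvatureBoostCovariance.Negative
  (OSPackage Translations Hypercubic EightFrameRP PlanarCone)
open Summit.QuantumFields.YangMills.Theorems.SoftKernelBoostCovariance.Negative (SoftKernel)
open Summit.QuantumFields.YangMills.Theorems.DiagonalMirrorRPR.Negative
  (constField constField_apply integral_linActMulti integral_appendTensor integral_osAdjoint
    constField_pullback_isReflectionPositive)

variable {n m : ℕ}

/-! ## §1 E0: normalisation and hermiticity -/

/-- `∫_{(ℝ⁴)⁰} F = F()`: Lebesgue measure on the one-point space `(ℝ⁴)⁰` is the Dirac mass. [folklore] -/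
theorem integral_finZero_eq_apply (F : 𝓢((Fin 0 → E4), ℂ)) : ∫ x, F x = F default := by
  rw [MeasureTheory.volume_pi, MeasureTheory.Measure.pi_of_empty (fun _ : Fin 0 => (volume : Measure E4)) default]
  exact integral_dirac _ _

/-- E0 (normalisation): `𝔖₀ F = F()` (Lebesgue measure on the one-point space is the Dirac mass). [folklore] -/
theorem isNormalized_constField (κ : ℝ) : (constField κ).toLabelled.IsNormalized := by
  intro k F
  rw [SchwingerFamily.toLabelled_apply, constField_apply, integral_finZero_eq_apply, pow_zero, one_mul]
  exact congrArg F (Subsingleton.elim _ _)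

/-- E0 (hermiticity): `κⁿ ∫F = conj (κⁿ ∫ θF*)` (`∫ θF* = conj ∫ F`, `κ` real). [folklore] -/
theorem isHermitian_constField (κ : ℝ) : (constField κ).toLabelled.IsHermitian := by
  intro n k F _
  rw [SchwingerFamily.toLabelled_apply, SchwingerFamily.toLabelled_apply, constField_apply, constField_apply,
    integral_osAdjoint, map_mul, map_pow, Complex.conj_ofReal, Complex.conj_conj]

/-! ## §2 E0' (linear growth) -/

/-- Pointwise decay from the Schwartz norm: `(1 + ‖x‖)ᵏ ‖F x‖ ≤ 2ᵏ |F|_k`. [folklore] -/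
theorem one_add_pow_mul_norm_le (k : ℕ) (F : 𝓢((Fin n → E4), ℂ)) (x : Fin n → E4) :
    (1 + ‖x‖) ^ k * ‖F x‖ ≤ 2 ^ k * schwartzNorm k F := by
  have h := SchwartzMap.one_add_le_sup_seminorm_apply (𝕜 := ℂ) (m := (k, k)) (k := k) (n := 0) le_rfl
    (Nat.zero_le k) F x
  rw [norm_iteratedFDeriv_zero] at h
  exact h

/-- The transverse weight `J = ∫_{ℝ⁴} (1 + ‖y‖)^{-5} dy` (finite: `5 > 4 = dim`). [folklore] -/
def J4 : ℝ := ∫ y : E4, (1 + ‖y‖) ^ (-(5 : ℝ))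

/-- The weight is integrable. [folklore] -/
theorem integrable_weight : Integrable fun y : E4 => (1 + ‖y‖) ^ (-(5 : ℝ)) :=
  integrable_one_add_norm (by rw [finrank_euclideanSpace, Fintype.card_fin]; norm_num)

/-- `0 ≤ J`. [folklore] -/
theorem J4_nonneg : 0 ≤ J4 := integral_nonneg fun y => Real.rpow_nonneg (by positivity) _

/-- **Product domination of the sup-norm weight**: `(1 + ‖x‖)^{-5n} ≤ ∏ᵢ (1 + ‖xᵢ‖)^{-5}` on `(ℝ⁴)ⁿ`
(`‖xᵢ‖ ≤ ‖x‖` for the sup norm). [folklore] -/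
theorem weight_le_prod (x : Fin n → E4) :
    ((1 + ‖x‖) ^ (n * 5))⁻¹ ≤ ∏ i, (1 + ‖x i‖) ^ (-(5 : ℝ)) := by
  have h1 : ∏ i : Fin n, (1 + ‖x i‖) ^ (5 : ℕ) ≤ (1 + ‖x‖) ^ (n * 5) := by
    calc ∏ i : Fin n, (1 + ‖x i‖) ^ (5 : ℕ) ≤ ∏ _i : Fin n, (1 + ‖x‖) ^ (5 : ℕ) :=
          Finset.prod_le_prod (fun i _ => by positivity) fun i _ => by
            gcongr
            exact norm_le_pi_norm x i
      _ = (1 + ‖x‖) ^ (n * 5) := by rw [Finset.prod_const, Finset.card_univ, Fintype.card_fin, ← pow_mul, mul_comm]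
  have h2 : ∏ i : Fin n, (1 + ‖x i‖) ^ (-(5 : ℝ)) = (∏ i : Fin n, (1 + ‖x i‖) ^ (5 : ℕ))⁻¹ := by
    rw [← Finset.prod_inv_distrib]
    refine Finset.prod_congr rfl fun i _ => ?_
    rw [Real.rpow_neg (by positivity), ← Real.rpow_natCast]
    norm_num
  rw [h2]
  exact inv_anti₀ (Finset.prod_pos fun i _ => by positivity) h1

/-- **`L¹` control by the Schwartz norm, with geometric constants**: `∫ ‖F‖ ≤ (32 J)ⁿ |F|_{5n}` on `(ℝ⁴)ⁿ`.
[folklore] -/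
theorem integral_norm_le_schwartzNorm (F : 𝓢((Fin n → E4), ℂ)) :
    ∫ x, ‖F x‖ ≤ (32 * J4) ^ n * schwartzNorm (n * 5) F := by
  have hN : 0 ≤ schwartzNorm (n * 5) F := schwartzNorm_nonneg _ _
  have hpt : ∀ x : Fin n → E4, ‖F x‖ ≤ 2 ^ (n * 5) * schwartzNorm (n * 5) F * ∏ i, (1 + ‖x i‖) ^ (-(5 : ℝ)) := by
    intro x
    have h := one_add_pow_mul_norm_le (n * 5) F x
    have hpos : 0 < (1 + ‖x‖) ^ (n * 5) := by positivity
    calc ‖F x‖ = ((1 + ‖x‖) ^ (n * 5))⁻¹ * ((1 + ‖x‖) ^ (n * 5) * ‖F x‖) := by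
          field_simp
      _ ≤ ((1 + ‖x‖) ^ (n * 5))⁻¹ * (2 ^ (n * 5) * schwartzNorm (n * 5) F) :=
          mul_le_mul_of_nonneg_left h (inv_nonneg.2 hpos.le)
      _ ≤ (∏ i, (1 + ‖x i‖) ^ (-(5 : ℝ))) * (2 ^ (n * 5) * schwartzNorm (n * 5) F) :=
          mul_le_mul_of_nonneg_right (weight_le_prod x) (by positivity)
      _ = 2 ^ (n * 5) * schwartzNorm (n * 5) F * ∏ i, (1 + ‖x i‖) ^ (-(5 : ℝ)) := by ring
  have hW : Integrable fun x : Fin n → E4 => ∏ i, (1 + ‖x i‖) ^ (-(5 : ℝ)) :=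
    Integrable.fintype_prod (f := fun (_ : Fin n) (y : E4) => (1 + ‖y‖) ^ (-(5 : ℝ))) fun _ => integrable_weight
  have hIW : ∫ x : Fin n → E4, ∏ i, (1 + ‖x i‖) ^ (-(5 : ℝ)) = J4 ^ n := by
    rw [MeasureTheory.volume_pi]
    rw [integral_fintype_prod_eq_pow (ι := Fin n) (fun y : E4 => (1 + ‖y‖) ^ (-(5 : ℝ)))]
    simp [J4]
  calc ∫ x, ‖F x‖ ≤ ∫ x : Fin n → E4, 2 ^ (n * 5) * schwartzNorm (n * 5) F * ∏ i, (1 + ‖x i‖) ^ (-(5 : ℝ)) :=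
        integral_mono F.integrable.norm (hW.const_mul _) hpt
    _ = 2 ^ (n * 5) * schwartzNorm (n * 5) F * J4 ^ n := by rw [integral_const_mul, hIW]
    _ = (32 * J4) ^ n * schwartzNorm (n * 5) F := by
        have h32 : (2 : ℝ) ^ (n * 5) = 32 ^ n := by rw [pow_mul']; norm_num
        rw [h32, mul_pow]; ring

/-- **E0' (linear growth) for the constant field**: order `s = 5`, `α = e^{32 J |κ|}`, `β = 1`
(`|κⁿ ∫F| ≤ (32 J |κ|)ⁿ |F|_{5n} ≤ e^{32J|κ|} n! |F|_{5n}`). [folklore] -/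
theorem hasLinearGrowth_constField (κ : ℝ) : (constField κ).toLabelled.HasLinearGrowth := by
  intro T
  refine ⟨5, Real.exp (32 * J4 * |κ|), 1, fun n k _ F _ => ?_⟩
  rw [SchwingerFamily.toLabelled_apply, constField_apply, norm_mul, norm_pow, Complex.norm_real,
    Real.norm_eq_abs, Real.rpow_one]
  have hN : 0 ≤ schwartzNorm (n * 5) F := schwartzNorm_nonneg _ _
  have hc : 0 ≤ 32 * J4 * |κ| := by have := J4_nonneg; positivity
  have hfac : (32 * J4 * |κ|) ^ n ≤ Real.exp (32 * J4 * |κ|) * n.factorial := by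
    have h := Real.pow_div_factorial_le_exp _ hc n
    rwa [div_le_iff₀ (by positivity)] at h
  calc |κ| ^ n * ‖∫ x, F x‖ ≤ |κ| ^ n * ((32 * J4) ^ n * schwartzNorm (n * 5) F) :=
        mul_le_mul_of_nonneg_left ((norm_integral_le_integral_norm _).trans (integral_norm_le_schwartzNorm F))
          (pow_nonneg (abs_nonneg κ) n)
    _ = (32 * J4 * |κ|) ^ n * schwartzNorm (n * 5) F := by ring
    _ ≤ Real.exp (32 * J4 * |κ|) * n.factorial * schwartzNorm (n * 5) F :=
        mul_le_mul_of_nonneg_right hfac hN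

/-! ## §3 E3 (symmetry), E4 (clustering), the package; translations, hypercubic invariance, gap -/

/-- Permuting the points preserves Lebesgue measure on `(ℝ⁴)ⁿ`: `∫ F(x ∘ π) = ∫ F`. [folklore] -/
theorem integral_permTest (π : Equiv.Perm (Fin n)) (F : 𝓢((Fin n → E4), ℂ)) :
    ∫ x, permTest π F x = ∫ x, F x := by
  let e : (Fin n → E4) ≃ᵐ (Fin n → E4) := (MeasurableEquiv.piCongrLeft (fun _ : Fin n => E4) π).symm
  have he : MeasurePreserving e volume volume := (volume_measurePreserving_piCongrLeft (fun _ : Fin n => E4) π).symm _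
  have h : (fun x => permTest π F x) = fun x => F (e x) := by
    funext x
    rw [permTest_apply]
    rfl
  rw [h]
  exact he.integral_comp' (fun y => F y)

/-- E3 (symmetry) for the constant field. [folklore] -/
theorem isSymmetric_constField (κ : ℝ) : (constField κ).toLabelled.IsSymmetric := by
  intro n k π F _
  rw [SchwingerFamily.toLabelled_apply, SchwingerFamily.toLabelled_apply, constField_apply, constField_apply,
    integral_permTest]

/-- E4 (clustering) for the constant field: the clustered quantity vanishes identically. [folklore] -/
theorem hasClusterProperty_constField (κ : ℝ) : (constField κ).toLabelled.HasClusterProperty := by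
  intro n m k k' F G _ _ a _ _ H hH
  refine (tendsto_const_nhds (x := (0 : ℂ))).congr fun t => ?_
  rw [SchwingerFamily.toLabelled_apply, SchwingerFamily.toLabelled_apply, SchwingerFamily.toLabelled_apply,
    constField_apply, constField_apply, constField_apply, integral_appendTensor (hH t), integral_translateMulti]
  ring

/-- E2 along `e₀` for the constant field (the identity frame of the landed all-frames RP). [folklore] -/
theorem isReflectionPositive_constField (κ : ℝ) : (constField κ).toLabelled.IsReflectionPositive :=
  (osReconstruction_constField κ).reflectionPositive

/-- **The OS package (E0, E0h, E0', E2, E3, E4) of the constant field.** [folklore] -/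
theorem osPackage_constField (κ : ℝ) : OSPackage (constField κ) :=
  ⟨isNormalized_constField κ, isHermitian_constField κ, hasLinearGrowth_constField κ,
    isReflectionPositive_constField κ, isSymmetric_constField κ, hasClusterProperty_constField κ⟩

/-- Translation invariance (on all of `𝓢`, a fortiori on `⁰𝒮`). [folklore] -/
theorem translations_constField (κ : ℝ) : Translations (constField κ) := fun n a F _ => by
  rw [constField_apply, constField_apply, integral_translateMulti]

/-- Invariance under every linear isometry (a fortiori proper hypercubic invariance on `⁰𝒮`). [folklore] -/
theorem hypercubic_constField (κ : ℝ) : Hypercubic (constField κ) := fun R _ _ n F _ => by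
  rw [constField_apply, constField_apply, integral_linActMulti]

/-- The continuum gap clause for every `Δ` (clustered quantity `0`, constant `0`). [folklore] -/
theorem hasMassGap_constField (κ Δ : ℝ) : (constField κ).toLabelled.HasMassGap Δ := by
  intro n m k k' F G _ _
  refine ⟨0, fun t _ H hH => ?_⟩
  rw [SchwingerFamily.toLabelled_apply, SchwingerFamily.toLabelled_apply, SchwingerFamily.toLabelled_apply,
    constField_apply, constField_apply, constField_apply, integral_appendTensor hH, integral_translateMulti]
  ring_nf
  simp

/-! ## §4 The eight frames, the planar cone, the soft kernel -/

/-- RP in the eight planar frames (indeed in every frame). [folklore] -/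
theorem eightFrameRP_constField (κ : ℝ) : EightFrameRP (constField κ) :=
  fun R _ _ _ _ _ => constField_pullback_isReflectionPositive κ R

/-- **The planar cone of the constant field**: `Φ ≡ κ^{n+m} conj(∫F) ∫G` (entire), and the Cauchy–Schwarz bound
is an equality. [folklore] -/
theorem planarCone_constField (κ : ℝ) : PlanarCone (constField κ) := by
  intro n m F G _ _
  refine ⟨fun _ => (κ : ℂ) ^ (n + m) * ((starRingEnd ℂ) (∫ x, F x) * ∫ x, G x), differentiableOn_const _,
    fun t b _ H hH => ?_, fun w _ HF HG hHF hHG => ?_⟩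
  · rw [constField_apply, integral_appendTensor hH, integral_osAdjoint, integral_translateMulti]
  · rw [constField_apply, constField_apply, integral_appendTensor hHF, integral_appendTensor hHG,
      integral_osAdjoint, integral_osAdjoint]
    simp only [norm_mul, norm_pow, Complex.norm_real, Real.norm_eq_abs, Complex.norm_conj]
    apply le_of_eq
    rw [pow_add]
    ring

/-- **The soft kernel of the constant field**: `K ≡ κ²`, `C = κ²`, `η = 1`. [folklore] -/
theorem softKernel_constField (κ : ℝ) : SoftKernel (constField κ) := by
  refine ⟨fun _ => κ ^ 2, κ ^ 2, 1, one_pos, continuousOn_const, fun x _ => ?_, fun F _ => ⟨?_, ?_⟩⟩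
  · rw [abs_of_nonneg (sq_nonneg κ)]
    have h : (0 : ℝ) ≤ ‖x‖ ^ ((1 : ℝ) - 10) := Real.rpow_nonneg (norm_nonneg _) _
    nlinarith [sq_nonneg κ]
  · exact F.integrable.const_mul _
  · rw [constField_apply, integral_const_mul]
    push_cast
    ring

end Summit.QuantumFields.YangMills.Theorems.CurvatureSandwichBound.Negative

end
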